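import Summits.BirchSwinnertonDyer.BirchSwinnertonDyer.Theses.ByReductionTypeAtTwo
import Summits.BirchSwinnertonDyer.BirchSwinnertonDyer.Theorems.AlignedTransportAtTwoMainConjectureOfRankZeroBSDAtTwoTorsionPointFieldDoors
import Literature.NumberTheory.IwasawaTheory.ClassicalMuInvariantOnePrimeProofs
import HarnessLib

/-!
# Route `ByReductionTypeAtTwo` (rung K4), crux C1″ `FineSelmerConjAAtTwoAdditivePotGood` (item stmt-BirchSwinnertonDyer-22615):
# the CUBIC-FIELD doors — C1″ from Iwasawa's `μ₂ = 0` for the `2`-torsion point field `ℚ(P)` (the cubic field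
# `K₃ = ℚ(e₁)` of the `2`-division cubic on the `S₃` scope), and its two NUMERIC certificate forms
# (Iwasawa 1956 — PROVED in the tree — and Fukuda 1994 Thm. 1 (2)), keyed to the route decl
# (a `--supports 22615` file; seat `bsd-2adic-k4-w1` GEN 0; sequel of `…FineSelmerConjAAtTwoAdditivePotGoodHeart`)

HONEST FRAMING (cell `bsd-2adic`, HUMAN RULING D-0036/D-0054): types-the-object-of; closes none at the ∀-level; nothing
booked; BSD is not proved by any of this. CONDITIONAL on Lim 2017 Thm. 3.5 + Lemma 3.2 at `p = 2` BY NAME (`hLim2`, a head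
of the support item 22619 `AdditivePrintedInputsAtTwo`) and, for the Fukuda form, on `fukuda1994_thm1_classGroupPRank_const_of_succ_eq`
(`hFuk`, PRINT, D-audit hFuk PASS); the Iwasawa-1956 form needs NO further fact
(`iwasawa1956_classNumberPExp_eq_zero_of_not_dvd_classNumber_of_unique_prime_holds`, tree theorem).

WHY (planner bsd-2adic-plan GEN 28, RC-272 pointer for C1″: «type C1″'s first `--supports` as "Conj A₂(E) ⟸ μ₂(K₃^cyc) = 0"
(helper), not as a class law»; 19573 lineage 1 GEN 7 (H-a)). The sibling `…Heart` file prices C1″ EXACTLY against the sextic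
`ℚ(W[2])` (necessity and sufficiency). The certificates the cell actually computes live on the CUBIC `K₃ = ℚ(P)` (`P ≠ 0` in
`W[2]`; degree `3`, `bnfcertify`-able; `r₁(K₃) = 1` for `Δ_W < 0`, inside the Lim@2 scope rider) — kit j289938/j289186 (addL2x
GEN 5/8: 835/1 145 irreducible block classes at `n₀ = 0`), `fukuda19573.gp` (all 8 residue `ρ̄`-classes of 19573). The
per-curve doors on `ℚ(P)` are the tree's (cell bsd-f1-sign2, `…AlignedTransportAtTwo…TorsionPointFieldDoors`:
`fineSelmerDual_moduleFinite_two_of_classicalMu_pointField` etc.). This file lifts them to the ∀-SHAPE of the route decl: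

* `fineSelmerConjAAtTwoAdditivePotGood_of_classicalMu_pointField` — C1″ ⟸ `hLim2` + «every scope curve has a non-zero
  `P ∈ W[2]` with `μ₂(ℚ(P)^{cyc}) = 0`» (Iwasawa's conjecture for the cubics `K₃`; OPEN in print for `S₃`-cubics).
* `fineSelmerConjAAtTwoAdditivePotGood_of_oddClassNumber_uniquePrime` — C1″ ⟸ `hLim2` + «every scope curve has a non-zero
  `P ∈ W[2]` with `h(ℚ(P))` ODD and EXACTLY ONE prime of `ℚ(P)` above `2`» (Iwasawa 1956, kernel theorem: then `2 ∤ h` up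
  the whole cyclotomic `ℤ₂`-tower). One prime above `2` in `K₃` ⟺ the `2`-division cubic is irreducible over `ℚ₂` ⟺
  `W(ℚ₂)[2] = 0`; a GRH-free, degree-`3` certificate.
* `fineSelmerConjAAtTwoAdditivePotGood_of_fukudaRankCertificates` — C1″ ⟸ `hLim2` + `hFuk` + «every scope curve has a
  non-zero `P` and layers `n₀ ≤ n` of the cyclotomic `ℤ₂`-tower of `ℚ(P)` with total ramification from `n₀` and
  `rank₂ Cl(ℚ(P)_{n+1}) = rank₂ Cl(ℚ(P)_n)`» (the census certificate shape).
* `fineSelmerConjAAtTwoAdditivePotGood_of_cubicCertificates` — the disjunction of the three, curve by curve (the honest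
  «supply law» of C1″: every `S₃` scope class carries ONE of the certificates or the bare `μ₂ = 0` of its cubic).

Nothing here is new mathematics; four compositions BY NAME. References: [Lim2017FineSelmer] Thm. 3.5, Lemma 3.2;
[Greenberg2001IwasawaPastPresent] Prop. 2.1 (Iwasawa 1956); [Fukuda1994] Thm. 1 (2); [CoatesSujatha2005] (A), Thm. 3.4.
-/

set_option autoImplicit false
-- sibling precedent (`ByReductionTypeAtTwoFineSelmerConjAAtTwoAdditivePotGoodHeart.lean`): the directory name repeats the summit name
set_option linter.dupNamespace false

noncomputable section

open scoped Classical

namespace Summit.BirchSwinnertonDyer.BirchSwinnertonDyer.Theorems.AddKatoTwo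

open WeierstrassCurve Field Literature.NumberTheory.EllipticCurves
  Literature.NumberTheory.EllipticCurves.Rank1Residual
  Literature.NumberTheory.GaloisRepresentations
  Literature.NumberTheory.IwasawaTheory IsDedekindDomain NumberField
  Summit.BirchSwinnertonDyer.BirchSwinnertonDyer.Theorems.AlignedTransportAtTwoTorsionPointField
  Summit.BirchSwinnertonDyer.BirchSwinnertonDyer.Theses.ByReductionTypeAtTwo

/-- **C1″ from Iwasawa's `μ₂ = 0` for the `2`-torsion point fields (the cubic door).** Granted Lim 2017 Thm. 3.5 + Lemma 3.2
at `p = 2` BY NAME (`hLim2`): if every curve of the scope of `FineSelmerConjAAtTwoAdditivePotGood` (non-CM, globally minimal,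
`r_an = 0`, additive potentially good at `2`, non-abelian `ℚ(W[2])`) has a non-zero `P ∈ W[2]` such that every cyclotomic
`ℤ₂`-extension of `ℚ(P) = ℚ̄^{Stab(P)}` (the cubic field `K₃` of a root of the `2`-division cubic) has classical `μ = 0`
(growth form), then C1″ holds. Lim's carrier hypotheses (`ℚ(P) ≤ ℚ(W[4])`, `2`-power index) are discharged in the tree
(`fineSelmerDual_moduleFinite_two_of_classicalMu_pointField`). Conditional; the hypothesis is Iwasawa's `μ`-conjecture at
`2` for these `S₃`-cubics (open in print). [cite: Lim2017FineSelmer, §3 Thm. 3.5 and Lemma 3.2]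
[cite: CoatesSujatha2005, statement (A) and Thm. 3.4] -/
theorem fineSelmerConjAAtTwoAdditivePotGood_of_classicalMu_pointField
    (hLim2 : Lim2017.thm35_at_two_fineSelmerDual_moduleFinite_of_classicalMuVanishes_of_le_divisionField_four)
    (hμ : ∀ (W : WeierstrassCurve ℚ) [W.IsElliptic] [W.IsGloballyMinimal], ¬ W.HasCM → W.analyticRank = 0 →
      Addv W 2 → 0 ≤ padicValRat 2 W.j → ¬ IsAbelianGalois ℚ (W.divisionField 2) →
      ∃ P : geomTorsion W 2, P ≠ 0 ∧
        ∀ κL : ZpExtension (IntermediateField.fixedField (MulAction.stabilizer (absoluteGaloisGroup ℚ) P)) 2,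
          κL.IsCyclotomic → ClassicalMuVanishes κL) :
    FineSelmerConjAAtTwoAdditivePotGood := by
  intro W _ _ hcm hr hadd hj hS3 κ hκ
  obtain ⟨P, hP, hμP⟩ := hμ W hcm hr hadd hj hS3
  exact fineSelmerDual_moduleFinite_two_of_classicalMu_pointField hLim2 W hP hμP κ hκ

/-- **C1″ from Iwasawa-1956 certificates on the cubic fields (one class number, one prime decomposition).** Granted `hLim2`
BY NAME: if every scope curve has a non-zero `P ∈ W[2]` whose point field `ℚ(P)` has ODD class number and EXACTLY ONE prime
above `2`, then C1″ holds — Iwasawa 1956 (PROVED in the tree: `iwasawa1956_…_holds`) makes `2 ∤ h` along the whole cyclotomic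
`ℤ₂`-tower of `ℚ(P)`, so `μ₂ = 0` in growth form, and the cubic door applies. One prime above `2` in `K₃` = the `2`-division
cubic irreducible over `ℚ₂` (`W(ℚ₂)[2] = 0`); GRH-free degree-`3` certificates. Conditional on `hLim2` only.
[cite: Greenberg2001IwasawaPastPresent, Prop. 2.1 p. 339] [cite: Lim2017FineSelmer, §3 Thm. 3.5 and Lemma 3.2] -/
theorem fineSelmerConjAAtTwoAdditivePotGood_of_oddClassNumber_uniquePrime
    (hLim2 : Lim2017.thm35_at_two_fineSelmerDual_moduleFinite_of_classicalMuVanishes_of_le_divisionField_four)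
    (hcert : ∀ (W : WeierstrassCurve ℚ) [W.IsElliptic] [W.IsGloballyMinimal], ¬ W.HasCM → W.analyticRank = 0 →
      Addv W 2 → 0 ≤ padicValRat 2 W.j → ¬ IsAbelianGalois ℚ (W.divisionField 2) →
      ∃ P : geomTorsion W 2, P ≠ 0 ∧
        ¬ 2 ∣ Nat.card (ClassGroup
          (𝓞 (IntermediateField.fixedField (MulAction.stabilizer (absoluteGaloisGroup ℚ) P)))) ∧
        ∃! v : HeightOneSpectrum
            (𝓞 (IntermediateField.fixedField (MulAction.stabilizer (absoluteGaloisGroup ℚ) P))),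
          ((2 : ℕ) : 𝓞 (IntermediateField.fixedField (MulAction.stabilizer (absoluteGaloisGroup ℚ) P))) ∈
            v.asIdeal) :
    FineSelmerConjAAtTwoAdditivePotGood := by
  refine fineSelmerConjAAtTwoAdditivePotGood_of_classicalMu_pointField hLim2 ?_
  intro W _ _ hcm hr hadd hj hS3
  obtain ⟨P, hP, hh, hv⟩ := hcert W hcm hr hadd hj hS3
  haveI := finiteDimensional_fixedField_stabilizer W P
  haveI : NumberField (IntermediateField.fixedField (MulAction.stabilizer (absoluteGaloisGroup ℚ) P)) :=
    NumberField.mk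
  have hh' : ¬ 2 ∣ NumberField.classNumber
      (IntermediateField.fixedField (MulAction.stabilizer (absoluteGaloisGroup ℚ) P)) := by
    rwa [NumberField.classNumber, ← Nat.card_eq_fintype_card]
  exact ⟨P, hP, fun κL _ ↦ classicalMuVanishes_of_classNumberPExp_eq_zero
    iwasawa1956_classNumberPExp_eq_zero_of_not_dvd_classNumber_of_unique_prime_holds hh' hv κL⟩

/-- **C1″ from Fukuda rank-stabilisation certificates on the cubic fields** (the census certificate shape). Granted `hLim2`
and Fukuda 1994 Thm. 1 (2) (`hFuk`) BY NAME: if every scope curve has a non-zero `P ∈ W[2]` and layers `n₀ ≤ n` such that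
every cyclotomic `ℤ₂`-extension of `ℚ(P)` is totally ramified from `n₀` at its ramified primes and has
`rank₂ Cl(ℚ(P)_{n+1}) = rank₂ Cl(ℚ(P)_n)`, then C1″ holds. Conditional on the two facts.
[cite: Fukuda1994, Thm. 1 (2), p. 264] [cite: Lim2017FineSelmer, §3 Thm. 3.5 and Lemma 3.2] -/
theorem fineSelmerConjAAtTwoAdditivePotGood_of_fukudaRankCertificates
    (hLim2 : Lim2017.thm35_at_two_fineSelmerDual_moduleFinite_of_classicalMuVanishes_of_le_divisionField_four)
    (hFuk : fukuda1994_thm1_classGroupPRank_const_of_succ_eq)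
    (hcert : ∀ (W : WeierstrassCurve ℚ) [W.IsElliptic] [W.IsGloballyMinimal], ¬ W.HasCM → W.analyticRank = 0 →
      Addv W 2 → 0 ≤ padicValRat 2 W.j → ¬ IsAbelianGalois ℚ (W.divisionField 2) →
      ∃ P : geomTorsion W 2, P ≠ 0 ∧ ∃ n₀ n : ℕ, n₀ ≤ n ∧
        ∀ κL : ZpExtension (IntermediateField.fixedField (MulAction.stabilizer (absoluteGaloisGroup ℚ) P)) 2,
          κL.IsCyclotomic → TotallyRamifiedFrom κL n₀ ∧ classGroupPRank κL (n + 1) = classGroupPRank κL n) :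
    FineSelmerConjAAtTwoAdditivePotGood := by
  refine fineSelmerConjAAtTwoAdditivePotGood_of_classicalMu_pointField hLim2 ?_
  intro W _ _ hcm hr hadd hj hS3
  obtain ⟨P, hP, n₀, n, hn, hc⟩ := hcert W hcm hr hadd hj hS3
  haveI := finiteDimensional_fixedField_stabilizer W P
  haveI : NumberField (IntermediateField.fixedField (MulAction.stabilizer (absoluteGaloisGroup ℚ) P)) :=
    NumberField.mk
  exact ⟨P, hP, fun κL hκL ↦
    classicalMuVanishes_of_classGroupPRank_succ_eq hFuk κL (hc κL hκL).1 hn (hc κL hκL).2⟩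

/-- **The supply law of C1″ on the cubic fields, curve by curve.** Granted `hLim2` and `hFuk` BY NAME: if every scope curve has
a non-zero `P ∈ W[2]` whose point field `ℚ(P)` carries EITHER an Iwasawa-1956 certificate (odd class number, one prime above
`2`) OR a Fukuda certificate (layers `n₀ ≤ n` with total ramification from `n₀` and equal `2`-ranks of the class groups at
`n`, `n + 1`) OR the bare classical `μ₂ = 0` of its cyclotomic `ℤ₂`-tower, then `FineSelmerConjAAtTwoAdditivePotGood`.
Conditional; the disjunct actually available on each of the `S₃` census classes is kit data of record (addL2x GEN 5/8,
19573 lineage), not asserted here. [cite: Greenberg2001IwasawaPastPresent, Prop. 2.1 p. 339] [cite: Fukuda1994, Thm. 1 (2), p. 264]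
[cite: Lim2017FineSelmer, §3 Thm. 3.5 and Lemma 3.2] -/
theorem fineSelmerConjAAtTwoAdditivePotGood_of_cubicCertificates
    (hLim2 : Lim2017.thm35_at_two_fineSelmerDual_moduleFinite_of_classicalMuVanishes_of_le_divisionField_four)
    (hFuk : fukuda1994_thm1_classGroupPRank_const_of_succ_eq)
    (hcert : ∀ (W : WeierstrassCurve ℚ) [W.IsElliptic] [W.IsGloballyMinimal], ¬ W.HasCM → W.analyticRank = 0 →
      Addv W 2 → 0 ≤ padicValRat 2 W.j → ¬ IsAbelianGalois ℚ (W.divisionField 2) →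
      ∃ P : geomTorsion W 2, P ≠ 0 ∧
        ((¬ 2 ∣ Nat.card (ClassGroup
            (𝓞 (IntermediateField.fixedField (MulAction.stabilizer (absoluteGaloisGroup ℚ) P)))) ∧
          ∃! v : HeightOneSpectrum
              (𝓞 (IntermediateField.fixedField (MulAction.stabilizer (absoluteGaloisGroup ℚ) P))),
            ((2 : ℕ) : 𝓞 (IntermediateField.fixedField (MulAction.stabilizer (absoluteGaloisGroup ℚ) P))) ∈
              v.asIdeal) ∨
        (∃ n₀ n : ℕ, n₀ ≤ n ∧
          ∀ κL : ZpExtension (IntermediateField.fixedField (MulAction.stabilizer (absoluteGaloisGroup ℚ) P)) 2,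
            κL.IsCyclotomic → TotallyRamifiedFrom κL n₀ ∧ classGroupPRank κL (n + 1) = classGroupPRank κL n) ∨
        (∀ κL : ZpExtension (IntermediateField.fixedField (MulAction.stabilizer (absoluteGaloisGroup ℚ) P)) 2,
            κL.IsCyclotomic → ClassicalMuVanishes κL))) :
    FineSelmerConjAAtTwoAdditivePotGood := by
  refine fineSelmerConjAAtTwoAdditivePotGood_of_classicalMu_pointField hLim2 ?_
  intro W _ _ hcm hr hadd hj hS3
  obtain ⟨P, hP, h⟩ := hcert W hcm hr hadd hj hS3
  haveI := finiteDimensional_fixedField_stabilizer W P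
  haveI : NumberField (IntermediateField.fixedField (MulAction.stabilizer (absoluteGaloisGroup ℚ) P)) :=
    NumberField.mk
  refine ⟨P, hP, fun κL hκL ↦ ?_⟩
  rcases h with ⟨hh, hv⟩ | ⟨n₀, n, hn, hc⟩ | hμ
  · have hh' : ¬ 2 ∣ NumberField.classNumber
        (IntermediateField.fixedField (MulAction.stabilizer (absoluteGaloisGroup ℚ) P)) := by
      rwa [NumberField.classNumber, ← Nat.card_eq_fintype_card]
    exact classicalMuVanishes_of_classNumberPExp_eq_zero
      iwasawa1956_classNumberPExp_eq_zero_of_not_dvd_classNumber_of_unique_prime_holds hh' hv κL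
  · exact classicalMuVanishes_of_classGroupPRank_succ_eq hFuk κL (hc κL hκL).1 hn (hc κL hκL).2
  · exact hμ κL hκL

/-! ## APPEND (same seat, same session): the class-number ORDER form of Fukuda's certificate (Thm. 1 (1)) — the form the
census of record mostly uses (`raw_verdict` FUKUDA-H / FUKUDA2-H / FUKUDA-Fi-H on 546 + 85 + 40 + … of the 1 382 rows of
`pub/bsd-2adic/addL2x/gen8/DOOR-ROWS-19098-addL2x-GEN8-conjA-v2-slim.tsv`; the RANK form above covers the `…-R` rows) -/

/-- **C1″ from Fukuda class-number (ORDER) stabilisation certificates on the cubic fields.** Granted `hLim2` and Fukuda 1994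
Thm. 1 (1) (`hF1`, `fukuda1994_thm1_classNumberPExp_const_of_succ_eq`) BY NAME: if every scope curve has a non-zero
`P ∈ W[2]` and layers `n₀ ≤ n` such that every cyclotomic `ℤ₂`-extension of `ℚ(P)` is totally ramified from `n₀` at its
ramified primes and has `ord₂ h(ℚ(P)_{n+1}) = ord₂ h(ℚ(P)_n)`, then C1″ holds. Conditional on the two facts.
[cite: Fukuda1994, Thm. 1 (1), p. 264] [cite: Lim2017FineSelmer, §3 Thm. 3.5 and Lemma 3.2] -/
theorem fineSelmerConjAAtTwoAdditivePotGood_of_fukudaOrderCertificates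
    (hLim2 : Lim2017.thm35_at_two_fineSelmerDual_moduleFinite_of_classicalMuVanishes_of_le_divisionField_four)
    (hF1 : fukuda1994_thm1_classNumberPExp_const_of_succ_eq)
    (hcert : ∀ (W : WeierstrassCurve ℚ) [W.IsElliptic] [W.IsGloballyMinimal], ¬ W.HasCM → W.analyticRank = 0 →
      Addv W 2 → 0 ≤ padicValRat 2 W.j → ¬ IsAbelianGalois ℚ (W.divisionField 2) →
      ∃ P : geomTorsion W 2, P ≠ 0 ∧ ∃ n₀ n : ℕ, n₀ ≤ n ∧
        ∀ κL : ZpExtension (IntermediateField.fixedField (MulAction.stabilizer (absoluteGaloisGroup ℚ) P)) 2,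
          κL.IsCyclotomic → TotallyRamifiedFrom κL n₀ ∧ classNumberPExp κL (n + 1) = classNumberPExp κL n) :
    FineSelmerConjAAtTwoAdditivePotGood := by
  refine fineSelmerConjAAtTwoAdditivePotGood_of_classicalMu_pointField hLim2 ?_
  intro W _ _ hcm hr hadd hj hS3
  obtain ⟨P, hP, n₀, n, hn, hc⟩ := hcert W hcm hr hadd hj hS3
  haveI := finiteDimensional_fixedField_stabilizer W P
  haveI : NumberField (IntermediateField.fixedField (MulAction.stabilizer (absoluteGaloisGroup ℚ) P)) :=
    NumberField.mk
  exact ⟨P, hP, fun κL hκL ↦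
    classicalMuVanishes_of_classNumberPExp_succ_eq hF1 κL (hc κL hκL).1 hn (hc κL hκL).2⟩

/-- **The supply law of C1″ on the cubic fields with all four disjuncts** (Iwasawa 1956 ∨ Fukuda order ∨ Fukuda rank ∨ bare
`μ₂ = 0`), curve by curve, granted `hLim2`, `hF1`, `hFuk` BY NAME. Conditional; which disjunct holds on which census class is
kit data of record, not asserted here. [cite: Greenberg2001IwasawaPastPresent, Prop. 2.1 p. 339] [cite: Fukuda1994, Thm. 1 (1), (2), p. 264]
[cite: Lim2017FineSelmer, §3 Thm. 3.5 and Lemma 3.2] -/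
theorem fineSelmerConjAAtTwoAdditivePotGood_of_cubicCertificates'
    (hLim2 : Lim2017.thm35_at_two_fineSelmerDual_moduleFinite_of_classicalMuVanishes_of_le_divisionField_four)
    (hF1 : fukuda1994_thm1_classNumberPExp_const_of_succ_eq)
    (hFuk : fukuda1994_thm1_classGroupPRank_const_of_succ_eq)
    (hcert : ∀ (W : WeierstrassCurve ℚ) [W.IsElliptic] [W.IsGloballyMinimal], ¬ W.HasCM → W.analyticRank = 0 →
      Addv W 2 → 0 ≤ padicValRat 2 W.j → ¬ IsAbelianGalois ℚ (W.divisionField 2) →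
      ∃ P : geomTorsion W 2, P ≠ 0 ∧
        ((¬ 2 ∣ Nat.card (ClassGroup
            (𝓞 (IntermediateField.fixedField (MulAction.stabilizer (absoluteGaloisGroup ℚ) P)))) ∧
          ∃! v : HeightOneSpectrum
              (𝓞 (IntermediateField.fixedField (MulAction.stabilizer (absoluteGaloisGroup ℚ) P))),
            ((2 : ℕ) : 𝓞 (IntermediateField.fixedField (MulAction.stabilizer (absoluteGaloisGroup ℚ) P))) ∈
              v.asIdeal) ∨
        (∃ n₀ n : ℕ, n₀ ≤ n ∧
          ∀ κL : ZpExtension (IntermediateField.fixedField (MulAction.stabilizer (absoluteGaloisGroup ℚ) P)) 2,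
            κL.IsCyclotomic → TotallyRamifiedFrom κL n₀ ∧ classNumberPExp κL (n + 1) = classNumberPExp κL n) ∨
        (∃ n₀ n : ℕ, n₀ ≤ n ∧
          ∀ κL : ZpExtension (IntermediateField.fixedField (MulAction.stabilizer (absoluteGaloisGroup ℚ) P)) 2,
            κL.IsCyclotomic → TotallyRamifiedFrom κL n₀ ∧ classGroupPRank κL (n + 1) = classGroupPRank κL n) ∨
        (∀ κL : ZpExtension (IntermediateField.fixedField (MulAction.stabilizer (absoluteGaloisGroup ℚ) P)) 2,
            κL.IsCyclotomic → ClassicalMuVanishes κL))) :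
    FineSelmerConjAAtTwoAdditivePotGood := by
  refine fineSelmerConjAAtTwoAdditivePotGood_of_classicalMu_pointField hLim2 ?_
  intro W _ _ hcm hr hadd hj hS3
  obtain ⟨P, hP, h⟩ := hcert W hcm hr hadd hj hS3
  haveI := finiteDimensional_fixedField_stabilizer W P
  haveI : NumberField (IntermediateField.fixedField (MulAction.stabilizer (absoluteGaloisGroup ℚ) P)) :=
    NumberField.mk
  refine ⟨P, hP, fun κL hκL ↦ ?_⟩
  rcases h with ⟨hh, hv⟩ | ⟨n₀, n, hn, hc⟩ | ⟨n₀, n, hn, hc⟩ | hμ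
  · have hh' : ¬ 2 ∣ NumberField.classNumber
        (IntermediateField.fixedField (MulAction.stabilizer (absoluteGaloisGroup ℚ) P)) := by
      rwa [NumberField.classNumber, ← Nat.card_eq_fintype_card]
    exact classicalMuVanishes_of_classNumberPExp_eq_zero
      iwasawa1956_classNumberPExp_eq_zero_of_not_dvd_classNumber_of_unique_prime_holds hh' hv κL
  · exact classicalMuVanishes_of_classNumberPExp_succ_eq hF1 κL (hc κL hκL).1 hn (hc κL hκL).2
  · exact classicalMuVanishes_of_classGroupPRank_succ_eq hFuk κL (hc κL hκL).1 hn (hc κL hκL).2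
  · exact hμ κL hκL

end Summit.BirchSwinnertonDyer.BirchSwinnertonDyer.Theorems.AddKatoTwo

end
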